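import Summits.QuantumFields.BalabanUV.T4Continuum.Support.NE3CovariantTentInterpolantMeanDefect
import HarnessLib

/-!
# T⁴ programme, node NE3 — row E-MLw-(w4)-P-curved, route H♮, row K5c♯ (file F♯2a): WEIGHTED LOCAL CONVEXITY, THE PATH BOUND,
# and the sharp vertex term of the interpolation–mean defect

NE3 (node U1b) formalisation swarm, leaf seat `b2b-balaban-t4-ne3-formalise-leaf-01` (gen 7); row **K5** of ruling ρ-g22-2, sub-row
**K5c♯** = LEVER (4) of the (P♮)_W census (D-ne3r2-g10-2 (4), `HOME/CLAIMS.log` l.20809; INTENT l.20912), file F♯2a (the kit of F♯2b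
`NE3TentMeanDefectSharp`).  WHERE THE ORDERS SIT.  File 4 `NE3CovariantTentInterpolantMeanDefect` bounds one block's defect through
UNWEIGHTED local convexity over the `2^d` cube vertices (`NE3CoarseInterpolant.normSq_interp_le`) times each vertex increment against the
WHOLE cube energy (`NE3BlockMeanExactLocal.normSq_vertex_sub_le_cube`, `2^d·d`).  THIS FILE keeps the multilinear WEIGHTS (they sum to `1`)
and telescopes each vertex increment along ITS OWN monotone `|T|`-edge path.

CONTENT ([folklore]; 0 sorry; 0 def):
§1 **weighted local convexity** `normSq_interpCore_le_weighted` ∕ `normSq_interp_le_weighted`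
   (`‖interp M S G y‖² ≤ Σ_{T⊆S} ω_T(y)·‖G(blk + indic T)‖²`, `ω_T = Π_{i∈T} wt_i·Π_{i∈S∖T}(1 − wt_i)`), `sum_weights_eq_one` (`Finset.prod_add`),
   `weights_nonneg`;
§2 **the path bound** `norm_vertex_sub_le_path` (`‖m(z + indic T) − m z‖ ≤ Σ_{i∈T} ‖dPot m (z + indic (T ∩ [0,i))) i‖`, induction on the
   maximum of `T`) and its square `normSq_vertex_sub_le_path` (`≤ |T|·Σ …²`);
§3 (`[Nonempty n]`, `W`, `U` unitary, `SmallField W a`, `SmallField U a_U`, `0 ≤ a, a_U, δ`, `‖U − bseg M W‖ ≤ δ`)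
   `normSq_frameData_sub_le_path` (K5b-2's `norm_dPot_frameData_cube_le` on the path) and **`normSq_vertexTerm_le_sharp`**:
   `‖m z − Ad_{btree_z(y)·btree_{z+1_T}(y)⁻¹}(m (z+1_T))‖² ≤ 2·[|T|·Σ_{i∈T}(2‖gaugeDir U m (z+1_{S_i}) i‖² + 8((d−1)a_U)²‖m(z+1_{S_i})‖²)] + 8(9d²M²a + dδ)²‖m(z+1_T)‖²`
   (`S_i = T ∩ [0,i)`; the kit's `norm_vertexDefect_le`: loop `≤ 3dM`, chain `≤ d`) — file 4's `normSq_vertexTerm_le` has `2·(2^d·d·cubeEnergy)` here.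

HONEST FRAMING.  Elementary lattice calculus of OUR interpolant at one background in the small-field class; nothing about Bałaban's
minimisers; (P♮)_W ∕ (ML_w) at W ≠ 1, T-E_w and **NE3 are NOT proved**; spine PROVED 0∕9; finite T⁴ rung (B)+1 — NOT infinite volume, NOT
mass gap, NOT `BetaPertH`, NOT Clay.  PLACEMENT: `Summits/QuantumFields/BalabanUV/`.  HONEST DEPENDENCY (cell page 1): continuum YM on T⁴ ⇐
BetaPertH ∧ nine spine estimates (0/9 proved); BetaPertH ⇐ (D1) ∧ (D4) ∧ CAP+tail; G-an2-4 gates asym, D1 and NE2/3/4.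
-/

set_option autoImplicit false

open scoped BigOperators Matrix.Norms.L2Operator
open Finset

namespace Summit.QuantumFields.BalabanUV.T4Continuum.NE3TentMeanDefectPath

open Literature.MathematicalPhysics.QuantumFieldTheory.Balaban1983to89
open B7Prop1Explicit B7Prop2Explicit
open T4AveragingDeficitWall (IsUnitaryCfg SmallField Ad)
open T4AveragingDeficitWallBoundary (periodBox mem_periodBox card_periodBox IsPeriodicCfg sum_periodBox_shift)
open T4AveragingDeficitNonAbelian (Ad_mul)
open AveragingDeficitTransport (norm_Ad_of_unitary)
open AveragingDeficitBlockDensity (btree bseg btree_mem card_offsets_real)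
open BlockAveragePushDirGauge (gaugeDir)
open SmoothRefineBlocks (blk res blk_res_eq_of)
open SmoothRefineInterp (indic indic_apply indic_insert interpCore interpCore_insert interpCore_const interp interp_sub wt wt_nonneg
  wt_le_one)
open NE3CoarseInterpolant (blk_block)
open NE3BlockLineAverage (sum_univ_boxVec)
open NE3TangentNoGoWords (dPot)
open NE3TentBump (wt_eq)
open NE3CovariantBlockMean (bmeanW)
open NE3CoarseFrameData (frameData frameData_self norm_dPot_frameData_cube_le)
open NE3BlockMeanExactInterpolant (normSq_sum_le_card_mul)
open NE3CovariantTentInterpolant (vtxW tinterpW Ad_interp)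
open NE3CovariantVertexDefect (norm_vertexDefect_le l1_le_of_abs_le' abs_block_sub_vertex_le abs_block_sub_corner_le
  abs_vertex_sub_corner_le abs_indic_le)


noncomputable section

variable {d : ℕ}

/-! ## §1 Weighted local convexity -/

section Convexity

variable {X : Type*} [NormedAddCommGroup X] [NormedSpace ℝ X]

/-- `‖(1 − t)•A + t•B‖² ≤ (1 − t)‖A‖² + t‖B‖²` for `t ∈ [0,1]` (convexity of the squared norm). [folklore] -/
theorem normSq_convex_le_weighted {t : ℝ} (ht0 : 0 ≤ t) (ht1 : t ≤ 1) (A B : X) :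
    ‖(1 - t) • A + t • B‖ ^ 2 ≤ (1 - t) * ‖A‖ ^ 2 + t * ‖B‖ ^ 2 := by
  have h1 : ‖(1 - t) • A + t • B‖ ≤ (1 - t) * ‖A‖ + t * ‖B‖ := by
    calc ‖(1 - t) • A + t • B‖ ≤ ‖(1 - t) • A‖ + ‖t • B‖ := norm_add_le _ _
      _ = (1 - t) * ‖A‖ + t * ‖B‖ := by
          rw [norm_smul, norm_smul, Real.norm_of_nonneg ht0, Real.norm_of_nonneg (by linarith)]
  have hA := norm_nonneg A
  have hB := norm_nonneg B
  have h2 : ((1 - t) * ‖A‖ + t * ‖B‖) ^ 2 ≤ (1 - t) * ‖A‖ ^ 2 + t * ‖B‖ ^ 2 := by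
    nlinarith [sq_nonneg (‖A‖ - ‖B‖), mul_nonneg ht0 (by linarith : 0 ≤ 1 - t)]
  exact (pow_le_pow_left₀ (norm_nonneg _) h1 2).trans h2

/-- **WEIGHTED LOCAL CONVEXITY**: for weights in `[0,1]`,
`‖interpCore S G z w‖² ≤ Σ_{T ⊆ S} (Π_{i∈T} w_i)(Π_{i∈S∖T} (1 − w_i))·‖G (z + indic T)‖²` — the multilinear weights kept (they sum to `1`);
`NE3CoarseInterpolant.normSq_interpCore_le` is this with every weight replaced by `1`. [folklore] -/
theorem normSq_interpCore_le_weighted (S : Finset (Fin d)) {w : Fin d → ℝ} (hw0 : ∀ i, 0 ≤ w i) (hw1 : ∀ i, w i ≤ 1) :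
    ∀ (G : Site d → X) (z : Site d),
      ‖interpCore S G z w‖ ^ 2 ≤ ∑ T ∈ S.powerset, ((∏ i ∈ T, w i) * ∏ i ∈ S \ T, (1 - w i)) * ‖G (z + indic T)‖ ^ 2 := by
  induction S using Finset.induction_on with
  | empty => intro G z; simp [interpCore]
  | insert i S hi ih =>
    intro G z
    rw [interpCore_insert hi, Finset.sum_powerset_insert hi]
    refine (normSq_convex_le_weighted (hw0 i) (hw1 i) _ _).trans (add_le_add ?_ ?_)
    · calc (1 - w i) * ‖interpCore S G z w‖ ^ 2
          ≤ (1 - w i) * ∑ T ∈ S.powerset, ((∏ j ∈ T, w j) * ∏ j ∈ S \ T, (1 - w j)) * ‖G (z + indic T)‖ ^ 2 :=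
            mul_le_mul_of_nonneg_left (ih G z) (by linarith [hw1 i])
        _ = _ := by
            rw [Finset.mul_sum]
            refine Finset.sum_congr rfl fun T hT => ?_
            rw [Finset.mem_powerset] at hT
            have hiT : i ∉ T := fun h => hi (hT h)
            rw [Finset.insert_sdiff_of_notMem S hiT, Finset.prod_insert (fun h => hi (Finset.mem_sdiff.1 h).1)]
            ring
    · calc w i * ‖interpCore S (fun x => G (x + e i)) z w‖ ^ 2
          ≤ w i * ∑ T ∈ S.powerset, ((∏ j ∈ T, w j) * ∏ j ∈ S \ T, (1 - w j)) * ‖G (z + indic T + e i)‖ ^ 2 :=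
            mul_le_mul_of_nonneg_left (ih (fun x => G (x + e i)) z) (hw0 i)
        _ = _ := by
            rw [Finset.mul_sum]
            refine Finset.sum_congr rfl fun T hT => ?_
            rw [Finset.mem_powerset] at hT
            have hiT : i ∉ T := fun h => hi (hT h)
            rw [Finset.prod_insert hiT, Finset.insert_sdiff_insert, Finset.sdiff_insert_of_notMem hi, indic_insert hiT,
              show z + (e i + indic T) = z + indic T + e i by abel]
            ring

/-- The weighted bound on the fine lattice: `‖interp M S G y‖² ≤ Σ_{T⊆S} ω_T(y)·‖G (blk M y + indic T)‖²`,
`ω_T(y) = Π_{i∈T} wt_i(y)·Π_{i∈S∖T} (1 − wt_i(y))`. [folklore] -/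
theorem normSq_interp_le_weighted {M : ℕ} (hM : 1 ≤ M) (S : Finset (Fin d)) (G : Site d → X) (y : Site d) :
    ‖interp M S G y‖ ^ 2
      ≤ ∑ T ∈ S.powerset, ((∏ i ∈ T, wt M y i) * ∏ i ∈ S \ T, (1 - wt M y i)) * ‖G (blk M y + indic T)‖ ^ 2 :=
  normSq_interpCore_le_weighted S (wt_nonneg hM y) (wt_le_one hM y) G _

end Convexity

/-- **THE WEIGHTS SUM TO ONE**: `Σ_{T⊆S} (Π_{i∈T} w_i)(Π_{i∈S∖T}(1 − w_i)) = 1` (`Finset.prod_add`). [folklore] -/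
theorem sum_weights_eq_one (S : Finset (Fin d)) (w : Fin d → ℝ) :
    ∑ T ∈ S.powerset, (∏ i ∈ T, w i) * ∏ i ∈ S \ T, (1 - w i) = 1 := by
  rw [← Finset.prod_add]
  simp

/-- The weights are nonnegative for `w ∈ [0,1]^d`. [folklore] -/
theorem weights_nonneg (S T : Finset (Fin d)) {w : Fin d → ℝ} (hw0 : ∀ i, 0 ≤ w i) (hw1 : ∀ i, w i ≤ 1) :
    0 ≤ (∏ i ∈ T, w i) * ∏ i ∈ S \ T, (1 - w i) :=
  mul_nonneg (Finset.prod_nonneg fun i _ => hw0 i) (Finset.prod_nonneg fun i _ => by linarith [hw1 i])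

/-! ## §2 The path bound for vertex increments -/

section Path

variable {𝔸 : Type*} [NormedRing 𝔸]

/-- **THE PATH BOUND**: `‖m (z + indic T) − m z‖ ≤ Σ_{i∈T} ‖dPot m (z + indic (T ∩ [0,i))) i‖` — telescoping along the monotone lattice
path that adds the directions of `T` in increasing order (`|T|` edges; `NE3BlockMeanExactLocal.norm_vertex_sub_le` enlarges this to all
`|T|·2^{|T|}` sub-cube edges). [folklore] -/
theorem norm_vertex_sub_le_path (m : Site d → 𝔸) (z : Site d) (T : Finset (Fin d)) :
    ‖m (z + indic T) - m z‖ ≤ ∑ i ∈ T, ‖dPot m (z + indic (T.filter (· < i))) i‖ := by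
  induction T using Finset.induction_on_max with
  | empty => simp
  | insert a s hlt ih =>
    have ha : a ∉ s := fun h => lt_irrefl a (hlt a h)
    have hsplit : m (z + indic (insert a s)) - m z = dPot m (z + indic s) a + (m (z + indic s) - m z) := by
      rw [indic_insert ha]; simp only [dPot]; abel_nf
    have hfa : (insert a s).filter (· < a) = s := by
      rw [Finset.filter_insert, if_neg (lt_irrefl a)]
      exact Finset.filter_true_of_mem fun x hx => hlt x hx
    have hfi : ∀ i ∈ s, (insert a s).filter (· < i) = s.filter (· < i) := by
      intro i hi
      rw [Finset.filter_insert, if_neg (not_lt.mpr (hlt i hi).le)]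
    rw [hsplit, Finset.sum_insert ha, hfa, Finset.sum_congr rfl fun i hi => by rw [hfi i hi]]
    exact (norm_add_le _ _).trans (add_le_add le_rfl ih)

/-- The path bound, squared: `‖m (z + indic T) − m z‖² ≤ |T|·Σ_{i∈T} ‖dPot m (z + indic (T ∩ [0,i))) i‖²`. [folklore] -/
theorem normSq_vertex_sub_le_path (m : Site d → 𝔸) (z : Site d) (T : Finset (Fin d)) :
    ‖m (z + indic T) - m z‖ ^ 2 ≤ (T.card : ℝ) * ∑ i ∈ T, ‖dPot m (z + indic (T.filter (· < i))) i‖ ^ 2 :=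
  (pow_le_pow_left₀ (norm_nonneg _) (norm_vertex_sub_le_path m z T) 2).trans sq_sum_le_card_mul_sum_sq

end Path

/-! ## §3 The frame datum along the path, and the vertex term -/

section Vertex

variable {n : Type*} [Fintype n] [DecidableEq n] [Nonempty n]

/-- **THE FRAME DATUM ALONG THE PATH** (`U` unitary, `SmallField U a_U`, `0 ≤ a_U`): with `S_i = T ∩ [0,i)`,
`‖frameData U m z (z + indic T) − m z‖² ≤ |T|·Σ_{i∈T} (2‖gaugeDir U m (z + indic S_i) i‖² + 8((d−1)a_U)²‖m (z + indic S_i)‖²)`. [folklore] -/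
theorem normSq_frameData_sub_le_path {U : Site d → Fin d → (Matrix n n ℂ)ˣ} (hU : IsUnitaryCfg U) {aU : ℝ} (haU : 0 ≤ aU)
    (hUa : SmallField U aU) (m : Site d → Matrix n n ℂ) (z : Site d) (T : Finset (Fin d)) :
    ‖frameData U m z (z + indic T) - m z‖ ^ 2
      ≤ (T.card : ℝ) * ∑ i ∈ T, (2 * ‖gaugeDir U m (z + indic (T.filter (· < i))) i‖ ^ 2
          + 8 * (((d : ℝ) - 1) * aU) ^ 2 * ‖m (z + indic (T.filter (· < i)))‖ ^ 2) := by
  have h := normSq_vertex_sub_le_path (frameData U m z) z T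
  rw [frameData_self] at h
  refine h.trans (mul_le_mul_of_nonneg_left (Finset.sum_le_sum fun i _ => ?_) (Nat.cast_nonneg _))
  set S := T.filter (· < i) with hS
  have hz1 : z ≤ z + indic S := by
    intro j; simp only [Pi.add_apply, indic_apply]; split_ifs <;> simp
  have hz2 : z + indic S ≤ z + fun _ => (1 : ℤ) := by
    intro j; simp only [Pi.add_apply, indic_apply]; split_ifs <;> simp
  have hb := norm_dPot_frameData_cube_le hU haU hUa m hz1 hz2 i
  have h0 : 0 ≤ 2 * (((d : ℝ) - 1) * aU) * ‖m (z + indic S)‖ := by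
    have : (0 : ℝ) ≤ (d : ℝ) - 1 := by
      have : (1 : ℝ) ≤ d := by exact_mod_cast Fin.pos i
      linarith
    positivity
  calc ‖dPot (frameData U m z) (z + indic S) i‖ ^ 2
      ≤ (‖gaugeDir U m (z + indic S) i‖ + 2 * (((d : ℝ) - 1) * aU) * ‖m (z + indic S)‖) ^ 2 := pow_le_pow_left₀ (norm_nonneg _) hb 2
    _ ≤ _ := by nlinarith [sq_nonneg (‖gaugeDir U m (z + indic S) i‖ - 2 * (((d : ℝ) - 1) * aU) * ‖m (z + indic S)‖)]

/-- **THE VERTEX TERM, SHARP** (`W`, `U` unitary; `SmallField W a`, `SmallField U a_U`; `0 ≤ a, a_U, δ`; `‖U − bseg M W‖ ≤ δ`;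
`v ∈ [0,M)^d`): one cube vertex read in the corner frame through the block site `M•z + v`,
`‖m z − Ad_{btree_z(y)·btree_{z+1_T}(y)⁻¹}(m (z + 1_T))‖² ≤ 2·[|T|·Σ_{i∈T}(2‖gaugeDir U m (z+1_{S_i}) i‖² + 8((d−1)a_U)²‖m(z+1_{S_i})‖²)] + 8(9d²M²a + dδ)²‖m (z + 1_T)‖²`
— the kit's `norm_vertexDefect_le` (loop `≤ 3dM`, chain `≤ d`) with the path bound in place of the cube energy. [folklore] -/
theorem normSq_vertexTerm_le_sharp {M : ℕ} {W U : Site d → Fin d → (Matrix n n ℂ)ˣ} (hW : IsUnitaryCfg W) (hU : IsUnitaryCfg U)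
    {a aU δ : ℝ} (ha : 0 ≤ a) (haU : 0 ≤ aU) (hδ0 : 0 ≤ δ) (hWa : SmallField W a) (hUa : SmallField U aU)
    (hδ : ∀ (x : Site d) (α : Fin d), ‖((U x α : (Matrix n n ℂ)ˣ) : Matrix n n ℂ) - bseg M W x α‖ ≤ δ)
    (m : Site d → Matrix n n ℂ) (z : Site d) {v : Site d} (hv : v ∈ periodBox (d := d) M) (T : Finset (Fin d)) :
    ‖m z - Ad (btree M W z ((M : ℤ) • z + v) * (btree M W (z + indic T) ((M : ℤ) • z + v))⁻¹) (m (z + indic T))‖ ^ 2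
      ≤ 2 * ((T.card : ℝ) * ∑ i ∈ T, (2 * ‖gaugeDir U m (z + indic (T.filter (· < i))) i‖ ^ 2
            + 8 * (((d : ℝ) - 1) * aU) ^ 2 * ‖m (z + indic (T.filter (· < i)))‖ ^ 2))
        + 8 * (9 * (d : ℝ) ^ 2 * (M : ℝ) ^ 2 * a + (d : ℝ) * δ) ^ 2 * ‖m (z + indic T)‖ ^ 2 := by
  have hzw : z ≤ z + indic T := by
    intro j; simp only [Pi.add_apply, indic_apply]; split_ifs <;> simp
  have h1 := norm_vertexDefect_le (M := M) hW hU ha hWa hδ m ((M : ℤ) • z + v) hzw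
  have hl1 : l1 ((M : ℤ) • z + v - (M : ℤ) • (z + indic T)) ≤ d * M := l1_le_of_abs_le' fun j => abs_block_sub_vertex_le z hv T j
  have hl2 : l1 ((M : ℤ) • z + v - (M : ℤ) • z) ≤ d * M := l1_le_of_abs_le' fun j => abs_block_sub_corner_le z hv j
  have hl3 : l1 ((M : ℤ) • (z + indic T) - (M : ℤ) • z) ≤ d * M := l1_le_of_abs_le' fun j => abs_vertex_sub_corner_le M z T j
  have hlT : l1 (z + indic T - z) ≤ d * 1 := l1_le_of_abs_le' fun j => abs_indic_le z T j
  have hℓ : (((l1 ((M : ℤ) • z + v - (M : ℤ) • (z + indic T)) + l1 ((M : ℤ) • z + v - (M : ℤ) • z)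
      + l1 ((M : ℤ) • (z + indic T) - (M : ℤ) • z) : ℕ) : ℝ)) ≤ 3 * (d : ℝ) * M := by
    have h3 : l1 ((M : ℤ) • z + v - (M : ℤ) • (z + indic T)) + l1 ((M : ℤ) • z + v - (M : ℤ) • z)
        + l1 ((M : ℤ) • (z + indic T) - (M : ℤ) • z) ≤ d * M + d * M + d * M := by omega
    have h4 : ((d * M + d * M + d * M : ℕ) : ℝ) = 3 * (d : ℝ) * M := by push_cast; ring
    exact le_trans (by exact_mod_cast h3) h4.le
  have hlT' : (l1 (z + indic T - z) : ℝ) ≤ d := by exact_mod_cast (hlT.trans (le_of_eq (mul_one d)))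
  have hq : (((l1 ((M : ℤ) • z + v - (M : ℤ) • (z + indic T)) + l1 ((M : ℤ) • z + v - (M : ℤ) • z)
      + l1 ((M : ℤ) • (z + indic T) - (M : ℤ) • z) : ℕ) : ℝ)) ^ 2 * a + (l1 (z + indic T - z) : ℝ) * δ
        ≤ 9 * (d : ℝ) ^ 2 * (M : ℝ) ^ 2 * a + (d : ℝ) * δ := by
    have h0 : (0 : ℝ) ≤ (((l1 ((M : ℤ) • z + v - (M : ℤ) • (z + indic T)) + l1 ((M : ℤ) • z + v - (M : ℤ) • z)
      + l1 ((M : ℤ) • (z + indic T) - (M : ℤ) • z) : ℕ) : ℝ)) := Nat.cast_nonneg _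
    have hsq := mul_le_mul_of_nonneg_right (pow_le_pow_left₀ h0 hℓ 2) ha
    have hch := mul_le_mul_of_nonneg_right hlT' hδ0
    have e9 : (3 * (d : ℝ) * M) ^ 2 * a = 9 * (d : ℝ) ^ 2 * (M : ℝ) ^ 2 * a := by ring
    linarith
  have hfd := normSq_frameData_sub_le_path hU haU hUa m z T
  have hQ0 : 0 ≤ 9 * (d : ℝ) ^ 2 * (M : ℝ) ^ 2 * a + (d : ℝ) * δ := by positivity
  have hE : ‖m z - Ad (btree M W z ((M : ℤ) • z + v) * (btree M W (z + indic T) ((M : ℤ) • z + v))⁻¹) (m (z + indic T))‖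
      ≤ ‖frameData U m z (z + indic T) - m z‖ + 2 * (9 * (d : ℝ) ^ 2 * (M : ℝ) ^ 2 * a + (d : ℝ) * δ) * ‖m (z + indic T)‖ := by
    refine h1.trans (add_le_add le_rfl ?_)
    exact mul_le_mul_of_nonneg_right (mul_le_mul_of_nonneg_left hq (by norm_num)) (norm_nonneg _)
  have hp0 := norm_nonneg (frameData U m z (z + indic T) - m z)
  have hm0 := norm_nonneg (m (z + indic T))
  calc ‖m z - Ad (btree M W z ((M : ℤ) • z + v) * (btree M W (z + indic T) ((M : ℤ) • z + v))⁻¹) (m (z + indic T))‖ ^ 2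
      ≤ (‖frameData U m z (z + indic T) - m z‖ + 2 * (9 * (d : ℝ) ^ 2 * (M : ℝ) ^ 2 * a + (d : ℝ) * δ) * ‖m (z + indic T)‖) ^ 2 :=
        pow_le_pow_left₀ (norm_nonneg _) hE 2
    _ ≤ 2 * ‖frameData U m z (z + indic T) - m z‖ ^ 2
          + 2 * (2 * (9 * (d : ℝ) ^ 2 * (M : ℝ) ^ 2 * a + (d : ℝ) * δ) * ‖m (z + indic T)‖) ^ 2 := by
        nlinarith [sq_nonneg (‖frameData U m z (z + indic T) - m z‖
          - 2 * (9 * (d : ℝ) ^ 2 * (M : ℝ) ^ 2 * a + (d : ℝ) * δ) * ‖m (z + indic T)‖)]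
    _ ≤ _ := by nlinarith [hfd]

end Vertex

end

end Summit.QuantumFields.BalabanUV.T4Continuum.NE3TentMeanDefectPath
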